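import Summits.Ventures.HSemireg.EmbeddedFirstOrderDeformationsCechMinusTwoH0
import Summits.Ventures.HSemireg.EmbeddedFirstOrderDeformationsCechMinusNCurve

/-!
# Venture HSemireg — `Ȟ⁰(Z, 𝒩) = 0` for `𝒪_{ℙ¹}(−n)`, EVERY `n ≥ 2` (general-exponent `…CechMinusTwoH0`): the `h⁰`
# column of the ladder is kernel over all integers (`h⁰(𝒪(−n)) = 0 ⟺ n ≥ 1`)

HONEST FRAMING.  Lean side of the computation cell `pub-hsemireg` (track «S4-PUSH» (ii), seat s4-prove-3 g6, second
route for (S5)); log `s4push/prove-3/ATTEMPT-10.md` §5m.  `…CechMinusTwoH0`'s argument with the exponent `2`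
replaced by `m + 1` (`m : ℕ`; the atlas `thickenedAtlas_minusN k m` of `…CechMinusNCurve`); `m = 0` re-proves
`…CechMinusOneRigid`'s `Ȟ⁰ = 0`, `m = 1` `…CechMinusTwoH0`'s.  Plain commutative algebra; no Mathlib scheme, sheaf,
abelian variety or semiregularity map; nothing here says that HC, HC_CM or HC_AV holds; no object is certified; no
Literature fact is declared.

WHAT: **`compatible_eq_zero_minusN`** (namespace `Summit.Ventures.HSemireg.EmbeddedDeformation.DoubledLine`).
With `…CechPositiveBundle` (`n ≤ 0`: a non-zero compatible family exists) the `h⁰` side of the ladder reads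
`Ȟ⁰ = 0 ⟺ n ≥ 1`, and the `h¹` side (`…CechPositiveBundle`/`…CechMinusOneCurve` vs `…CechMinusNCurve`) reads
lift ⟺ `n ≤ 1` — for the one twist `s⁻¹∂/∂p`, exactly as Thm. 6.2 (b) with `H^i(ℙ¹, 𝒪(−n))` predicts.

References: R. Hartshorne, *Deformation Theory*, GTM 257 (2010), §6 Thm. 6.2 (b) [corpus:
book:springernd-deformation-theory p0054].
-/

namespace Summit.Ventures.HSemireg

namespace EmbeddedDeformation

namespace DoubledLine

open DualNumber TrivSqZeroExt MvPolynomial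

universe u

variable (k : Type u) [CommRing k] (m : ℕ)

/-- **`Ȟ⁰(Z, 𝒩) = 0` for the `(−m−1)`-atlas, every `m`** (`H⁰(ℙ¹, 𝒪(−n)) = 0` for `n ≥ 1`): a compatible family
`ψ` along the chart maps `resMN k m` (any base local lifts) is ZERO — at the generator
`s^{m+1}·a ≡ psiN(b) (mod p)`, i.e. `x^{m+1}·a(x,0) = b(x⁻¹,0)` in `k[x]_x`. [cite: Hartshorne2010, §6 Thm. 6.2 (b)] -/
theorem compatible_eq_zero_minusN {T : ∀ α : Fin 2, Ideal (A k)[ε]}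
    (hT : ∀ α, IsLift (fstRingHom (A k)) (ε : (A k)[ε]) (idealZ k α) (T α))
    (ψ : ∀ α : Fin 2, idealZ k α →ₗ[A k] A k ⧸ idealZ k α)
    (hψ : ∀ α β, resL (thickenedAtlas_minusN k m) hT α β (ψ α) = resR (thickenedAtlas_minusN k m) hT α β (ψ β)) :
    ψ = 0 := by
  have 𝔄 := thickenedAtlas_minusN k m
  have hX1 : (X 1 : A k) ∈ idealZ k 0 := Ideal.subset_span rfl
  have hX1' : (X 1 : A k) ∈ idealZ k 1 := Ideal.subset_span rfl
  have hmem : algebraMap (A k) (L k) (X 1) ∈ idealZ₂ k 0 1 := Ideal.mem_map_of_mem _ (Ideal.subset_span rfl)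
  have hmem₁ : resMN k m 1 (X 1) ∈ idealZ₂ k 0 1 := by
    rw [resMN_one_X_one]
    exact Ideal.mul_mem_left _ _ hmem
  obtain ⟨a, ha⟩ := Ideal.Quotient.mk_surjective (ψ 0 ⟨X 1, hX1⟩)
  obtain ⟨b, hb⟩ := Ideal.Quotient.mk_surjective (ψ 1 ⟨X 1, hX1'⟩)
  have e0 : resL (thickenedAtlas_minusN k m) hT 0 1 (ψ 0) ⟨algebraMap (A k) (L k) (X 1), hmem⟩ =
      Ideal.Quotient.mk (idealZ₂ k 0 1) (algebraMap (A k) (L k) a) :=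
    resNormal_apply (𝔄.homl 0 1) (𝔄.liftsl 0 1) (hT 0) (ψ 0) ⟨X 1, hX1⟩ a ha hmem
  have e1 : resR (thickenedAtlas_minusN k m) hT 0 1 (ψ 1) ⟨resMN k m 1 (X 1), hmem₁⟩ =
      Ideal.Quotient.mk (idealZ₂ k 0 1) (resMN k m 1 b) :=
    resNormal_apply (𝔄.homr 0 1) (𝔄.liftsr 0 1) (hT 1) (ψ 1) ⟨X 1, hX1'⟩ b hb hmem₁
  have hx1 : (⟨resMN k m 1 (X 1), hmem₁⟩ : idealZ₂ k 0 1) =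
      (algebraMap (A k) (L k) (X 0) ^ (m + 1)) • (⟨algebraMap (A k) (L k) (X 1), hmem⟩ : idealZ₂ k 0 1) :=
    Subtype.ext (by
      show resMN k m 1 (X 1) = algebraMap (A k) (L k) (X 0) ^ (m + 1) • algebraMap (A k) (L k) (X 1)
      rw [resMN_one_X_one, smul_eq_mul])
  rw [hx1, ← hψ 0 1, map_smul, e0] at e1
  have hsm : ∀ c z : L k, c • Ideal.Quotient.mk (idealZ₂ k 0 1) z = Ideal.Quotient.mk (idealZ₂ k 0 1) (c * z) :=
    fun _ _ ↦ rfl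
  rw [hsm, Ideal.Quotient.eq] at e1
  have hev := ev_eq_zero_of_mem k e1
  rw [map_sub, map_mul, map_pow, ev_algebraMap_X_zero, ev_algebraMap_eq k a, resMN_one, RingHom.comp_apply]
    at hev
  change _ - ev k (psiNHom k m (algebraMap (A k) (L k) b)) = 0 at hev
  rw [psiNHom_algebraMap, ← RingHom.comp_apply (ev k) (psiN₀ k m), ev_comp_psiN₀, eval₂Hom_pair_zero, sub_eq_zero]
    at hev
  have hinv : ev k (IsLocalization.Away.invSelf (X 0 : A k)) *
      algebraMap (Polynomial k) (Localization.Away (Polynomial.X : Polynomial k)) Polynomial.X = 1 := by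
    rw [← ev_algebraMap_X_zero, ← map_mul, mul_comm, IsLocalization.Away.mul_invSelf, map_one]
  obtain ⟨ha0, hb0⟩ := eq_zero_of_laurent_identity_pow k (m + 1) (by omega) _ _ hinv hev
  have h0 : ψ 0 = 0 := ext_of_X_one k hX1 (by rw [ha.symm, LinearMap.zero_apply, mk_eq_zero_of_spec_eq_zero k 0 ha0])
  have h1 : ψ 1 = 0 :=
    ext_of_X_one k hX1' (by rw [hb.symm, LinearMap.zero_apply, mk_eq_zero_of_spec_eq_zero k 1 hb0])
  funext α
  fin_cases α
  · exact h0
  · exact h1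

end DoubledLine

end EmbeddedDeformation

end Summit.Ventures.HSemireg
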